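import Mathlib
import Literature.Algebra.Polynomial.PutinarTheoremHolds
import Literature.Combinatorics.SimpleGraph.CliqueTree
import HarnessLib

/-!
# Putinar certificates respecting a block structure of the variables: Lasserre's sparse
# Positivstellensatz under the running intersection property
# (Lasserre 2006, Corollary 3.9; Kojima–Muramatsu 2006; proof of Grimm–Netzer–Schweighofer 2007)

Topic `Literature/Algebra/Polynomial`, namespace
`Literature.Algebra.Polynomial.SparsePutinarPositivstellensatz`.

## Sources, read on the page

* D. Grimm, T. Netzer, M. Schweighofer, *A note on the representation of positive polynomials with
  structured sparsity*, Arch. Math. 89 (2007) 399–403 [held text `paper:arxiv-math_0611498`,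
  chunks 3–5 = §1 Introduction (Theorem 1 (Putinar), Corollary 2 (Cassier)), §2 The Theorem
  ((RIP), Lemma 3, Theorem 4, Corollary 5 (Lasserre, Kojima, Muramatsu)), References].
  - (RIP): «For all `i = 1,…,r`, there is `k < i` such that `I_i ∩ ⋃_{j<i} I_j ⊆ I_k`» for
    non-empty `I_1,…,I_r ⊆ {1,…,n}`; «(RIP) is empty in the case `r ≤ 2`».
  - **Lemma 3.** «Let `K ⊆ ℝ` be compact. Suppose `f = f_1 + … + f_r` with `f_j ∈ ℝ[X_{I_j}]` and
    `f > 0` on `Kⁿ`. Then `f = h_1 + … + h_r` for some `h_j ∈ ℝ[X_{I_j}]` with `h_j > 0` on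
    `K^{I_j}`.»  Proof (case `r = 2`): with `f ≥ ε > 0` on `Kⁿ`,
    `h(y) = min{f_1(x,y) | x ∈ K^{I_1∖I_2}} − ε/2` is (uniformly) continuous on `K^{I_1 ∩ I_2}`,
    `f_1 − h ≥ ε/2` on `K^{I_1}` and `f_2 + h ≥ ε/2` on `K^{I_2}`; approximate `h` by a polynomial
    `p ∈ ℝ[X_{I_1 ∩ I_2}]` with `|h − p| ≤ ε/4`; then `h_1 := f_1 − p > 0`, `h_2 := f_2 + p > 0`.
    Induction step: split `f = f̃ + f_r`, `f̃ = f_1 + … + f_{r−1} ∈ ℝ[X_{⋃_{j<r} I_j}]`; by (RIP)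
    the correcting polynomial `p ∈ ℝ[X_{I_r ∩ ⋃_{j<r} I_j}]` lies in some `ℝ[X_{I_k}]`, `k < r`.
  - **Theorem 4.** «Suppose `f = f_1 + … + f_r` with `f_j ∈ ℝ[X_{I_j}]` and `f > 0` on `S`. Then
    for any bounded set `C ⊆ ℝⁿ`, there are `0 < λ ≤ 1`, `k ∈ ℕ` and polynomials
    `h_j ∈ ℝ[X_{I_j}]` with `h_j > 0` on `C` such that
    `f = Σ_{j=1}^r Σ_{i=1}^{l_j} (1 − λ g_i^{(j)})^{2k} g_i^{(j)} + Σ_{j=1}^r h_j`.»  Here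
    `g_1^{(j)},…,g_{l_j}^{(j)} ∈ ℝ[X_{I_j}]` and `S ⊆ ℝⁿ` is the basic closed semialgebraic set they
    define; proof: `C ⊆ Kⁿ` for a compact `K ⊂ ℝ`, `λ g_i^{(j)} ≤ 1` on `Kⁿ`,
    `f_k := f − Σ (1 − λ g)^{2k} g` is nondecreasing in `k` and eventually positive at every point
    of `Kⁿ`, hence `f_k > 0` on `Kⁿ` for one `k` by compactness; apply Lemma 3 to `f_k`.
  - **Corollary 5 (Lasserre, Kojima, Muramatsu).** «Let the quadratic modules `M_j` generated by
    `g_1^{(j)},…,g_{l_j}^{(j)}` in `ℝ[X_{I_j}]` be archimedean. If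
    `f ∈ ℝ[X_{I_1}] + … + ℝ[X_{I_r}]` and `f > 0` on `S`, then `f ∈ M_1 + … + M_r`.»
* J. B. Lasserre, *Convergent SDP-relaxations in polynomial optimization with sparsity*, SIAM J.
  Optim. 17 (2006) 822–843 [held text `paper:doi-10-1137-05064504x`]: p. 3 condition (1.3)
  «For every `k = 1,…,p−1`, `I_{k+1} ∩ ⋃_{j=1}^k I_j ⊆ I_s` for some `s ≤ k`» («known as the
  running intersection property»); p. 11 **Corollary 3.9** (the representation (3.15)
  `f = Σ_{k=1}^p (q_k + Σ_{j∈J_k} q_{jk} g_j)` with s.o.s. `q_k, q_{jk} ∈ ℝ[X(I_k)]`, for `K` with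
  non-empty interior) and footnote 1 («Kojima and Maramatsu have improved Corollary 3.9 and show
  the same result without assuming that `K` has a nonempty interior»).

## What is formalised (everything proved; no named facts)

Variables are indexed by a type `σ` (a `Fintype` from §3 on), points are `x : σ → ℝ`, the box
`K^σ` is `box K`, and «`p ∈ ℝ[X_I]`» is Mathlib's `p ∈ MvPolynomial.supported ℝ I`.  The block
structure is `I : Fin r → Set σ` and (RIP) is the tree's
`Literature.Combinatorics.SimpleGraph.IndexedRunningIntersection` (file `CliqueTree.lean`:
`∀ i ≥ 1, ∃ j < i, I i ∩ ⋃_{j'<i} I j' ⊆ I j` — literally (RIP), the condition for the first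
block being void), so that the chordal-graph files of the tree (maximal cliques of a chordal
correlative-sparsity graph enumerate with (RIP): `IsChordal.exists_runningIntersection_maximalCliques`,
`runningIntersection_ofFn_iff`) feed this file directly.

* §0 `box`, `eval_eq_of_mem_supported` (a polynomial in `X_I` only sees the `I`-coordinates).
* §1 `exists_mvPolynomial_near` — multivariate Weierstrass approximation on a compact subset of
  `ℝ^τ` (from Mathlib's Stone–Weierstrass theorem; the polynomial functions separate points).
* §2 ★ `exists_split_of_pos` — the case `r = 2` of Lemma 3 for two arbitrary variable sets
  `A, B ⊆ σ`: `f_1 ∈ ℝ[X_A]`, `f_2 ∈ ℝ[X_B]`, `f_1 + f_2 > 0` on `K^σ` (`K` compact, non-empty)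
  give `p ∈ ℝ[X_{A∩B}]` with `f_1 − p > 0` and `f_2 + p > 0` on `K^σ` (GNS's `h`, `ε/2`, `ε/4`).
* §3 ★ `exists_pos_summands` — **Lemma 3** for `r` blocks with (RIP), by GNS's induction.
* §4 ★★ `exists_sparse_decomposition` — **Theorem 4** as printed (`0 < λ ≤ 1`, one exponent
  `2k`, `h_j > 0` on the bounded set).
* §5 ★★ `sparse_putinar` — **Corollary 5** = Lasserre 2006 Cor. 3.9 without the interior
  assumption (Kojima–Muramatsu): with `M_j = quadraticModule (g j)` in the ring
  `MvPolynomial ↥(I j) ℝ` (the tree's `quadraticModule`, `IsArchimedeanModule`) archimedean for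
  every `j`, every `f = Σ_j f_j`, `f_j ∈ ℝ[X_{I_j}]`, positive on `S` is `Σ_j rename(m_j)` with
  `m_j ∈ M_j`; Putinar's theorem enters through the tree's PROVED `putinarTheorem_holds`
  (`mem_quadraticModule_of_pos'`), where GNS take only Cassier's Corollary 2 for granted.

Positivity «`h_j > 0` on `K^{I_j}`» for `h_j ∈ ℝ[X_{I_j}]` is stated as positivity on the whole
box `K^σ` (equivalent for non-empty `K`, since `h_j` ignores the other coordinates —
`eval_eq_of_mem_supported`; for empty `K` and non-empty blocks both are void).  The families of
constraints `g_1^{(j)},…,g_{l_j}^{(j)}` are `g j : ι j → _` over finite index types `ι j`.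

## References

* [GrimmNetzerSchweighofer2007] D. Grimm, T. Netzer, M. Schweighofer, *A note on the
  representation of positive polynomials with structured sparsity*, Arch. Math. 89 (2007)
  399–403, doi:10.1007/s00013-007-2234-z — §2: (RIP), Lemma 3, Theorem 4, Corollary 5.
* [Lasserre2006] J. B. Lasserre, *Convergent SDP-relaxations in polynomial optimization with
  sparsity*, SIAM J. Optim. 17 (2006) 822–843, doi:10.1137/05064504X — p. 3 (1.3), p. 11
  Corollary 3.9 and footnote 1 (Kojima–Muramatsu).
* M. Kojima, M. Muramatsu, *A note on sparse SOS and SDP relaxations for polynomial optimization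
  problems over symmetric cones*, Research Report B-421, Tokyo Institute of Technology (2006)
  (cited through [GrimmNetzerSchweighofer2007, ref. [km]]; not held).
-/

noncomputable section

open MvPolynomial Finset Filter Topology

open scoped BigOperators

namespace Literature.Algebra.Polynomial.SparsePutinarPositivstellensatz

open Literature.Algebra.Polynomial.PutinarPositivstellensatz
open Literature.Algebra.Polynomial.PutinarTheoremHolds (mem_quadraticModule_of_pos')
open Literature.Combinatorics.SimpleGraph (iUnionLT IndexedRunningIntersection mem_iUnionLT)

variable {σ : Type*}

/-! ### §0 Boxes `K^σ` and polynomials in a subset of the variables -/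

/-- The cartesian power `K^σ = {x : σ → ℝ | ∀ i, x i ∈ K}` («`Kⁿ`», «`K^{I}`»).
[cite: GrimmNetzerSchweighofer2007, §2 Lemma 3] -/
def box (K : Set ℝ) : Set (σ → ℝ) := Set.univ.pi fun _ => K

/-- Membership in the box. [cite: GrimmNetzerSchweighofer2007, §2 Lemma 3] -/
theorem mem_box {K : Set ℝ} {x : σ → ℝ} : x ∈ (box K : Set (σ → ℝ)) ↔ ∀ i, x i ∈ K := by
  simp [box]

/-- `Kⁿ` is compact for compact `K` (Tychonoff). [cite: GrimmNetzerSchweighofer2007, §2 proof of Theorem 4] -/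
theorem isCompact_box {K : Set ℝ} (hK : IsCompact K) : IsCompact (box K : Set (σ → ℝ)) :=
  isCompact_univ_pi fun _ => hK

/-- `Kⁿ` is non-empty for non-empty `K`. [cite: GrimmNetzerSchweighofer2007, §2 proof of Lemma 3] -/
theorem box_nonempty {K : Set ℝ} (hK : K.Nonempty) : (box K : Set (σ → ℝ)).Nonempty := by
  obtain ⟨a, ha⟩ := hK
  exact ⟨fun _ => a, mem_box.2 fun _ => ha⟩

/-- «an element of `ℝ[X_I]` can be seen as a function on `ℝ^I`»: a polynomial in the variables
`X_s` takes the same value at two points agreeing on `s`.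
[cite: GrimmNetzerSchweighofer2007, §2 first paragraph] -/
theorem eval_eq_of_mem_supported {s : Set σ} {p : MvPolynomial σ ℝ} (hp : p ∈ supported ℝ s)
    {x y : σ → ℝ} (h : ∀ i ∈ s, x i = y i) : eval x p = eval y p := by
  rw [mem_supported] at hp
  refine hom_congr_vars ?_ (fun i hi _ => ?_) rfl
  · ext r
    simp
  · rw [eval_X, eval_X]
    exact h i (hp (Finset.mem_coe.2 hi))

/-- Constants lie in every `ℝ[X_s]`. [cite: GrimmNetzerSchweighofer2007, §2 first paragraph] -/
theorem C_mem_supported (s : Set σ) (a : ℝ) : (C a : MvPolynomial σ ℝ) ∈ supported ℝ s := by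
  rw [← MvPolynomial.algebraMap_eq]
  exact Subalgebra.algebraMap_mem _ a

/-- `rename` from the variables of `s` lands in `ℝ[X_s]`.
[cite: GrimmNetzerSchweighofer2007, §2 first paragraph] -/
theorem rename_mem_supported (s : Set σ) (q : MvPolynomial s ℝ) :
    rename ((↑) : s → σ) q ∈ supported ℝ s := by
  rw [supported_eq_range_rename]
  exact ⟨q, rfl⟩

/-- Every element of `ℝ[X_s]` is `rename` of a polynomial in the variables of `s`.
[cite: GrimmNetzerSchweighofer2007, §2 first paragraph] -/
theorem exists_eq_rename_of_mem_supported {s : Set σ} {p : MvPolynomial σ ℝ}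
    (hp : p ∈ supported ℝ s) : ∃ q : MvPolynomial s ℝ, p = rename ((↑) : s → σ) q := by
  rw [supported_eq_range_rename] at hp
  obtain ⟨q, hq⟩ := hp
  exact ⟨q, hq.symm⟩

/-! ### §1 Multivariate Weierstrass approximation on a compact set -/

/-- The coordinate functions of `ℝ^τ` as continuous maps. [folklore] -/
private def coordMap {τ : Type*} (t : τ) : C(τ → ℝ, ℝ) := ⟨fun y => y t, continuous_apply t⟩

/-- Polynomials as continuous functions on `ℝ^τ`: the algebra map `q ↦ (y ↦ q(y))`. [folklore] -/
private def polyMap (τ : Type*) : MvPolynomial τ ℝ →ₐ[ℝ] C(τ → ℝ, ℝ) := aeval coordMap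

/-- The polynomial function of `q` evaluates as `q`. [folklore] -/
private theorem polyMap_apply {τ : Type*} (q : MvPolynomial τ ℝ) (y : τ → ℝ) :
    polyMap τ q y = eval y q := by
  have h1 : (ContinuousMap.evalAlgHom ℝ ℝ y).comp (polyMap τ) = aeval fun t => y t := by
    refine MvPolynomial.algHom_ext fun t => ?_
    simp [polyMap, coordMap]
  have h2 := congrArg (fun ψ : MvPolynomial τ ℝ →ₐ[ℝ] ℝ => ψ q) h1
  simp only [AlgHom.comp_apply, ContinuousMap.evalAlgHom_apply] at h2
  rw [h2, aeval_eq_eval₂Hom]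
  rfl

/-- The polynomial functions separate the points of `ℝ^τ` (coordinates). [folklore] -/
private theorem polyMap_separatesPoints (τ : Type*) : (polyMap τ).range.SeparatesPoints := by
  intro x y hxy
  obtain ⟨t, ht⟩ := Function.ne_iff.mp hxy
  refine ⟨polyMap τ (X t), ⟨polyMap τ (X t), ⟨X t, rfl⟩, rfl⟩, ?_⟩
  rw [polyMap_apply, polyMap_apply, eval_X, eval_X]
  exact ht

/-- **Weierstrass approximation in several variables** («Now approximate `h` by a polynomial
`p ∈ ℝ[X_{I_1 ∩ I_2}]` such that `|h − p| ≤ ε/4` on `K^{I_1∩I_2}`»): a continuous function on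
`ℝ^τ` is uniformly approximable by polynomials on any compact set (Mathlib's Stone–Weierstrass
theorem applied to the point-separating subalgebra of polynomial functions).
[cite: GrimmNetzerSchweighofer2007, §2 proof of Lemma 3] -/
theorem exists_mvPolynomial_near {τ : Type*} {K : Set (τ → ℝ)} (hK : IsCompact K)
    {φ : (τ → ℝ) → ℝ} (hφ : Continuous φ) {ε : ℝ} (hε : 0 < ε) :
    ∃ q : MvPolynomial τ ℝ, ∀ y ∈ K, |eval y q - φ y| < ε := by
  obtain ⟨g, ⟨q, rfl⟩, hg⟩ :=
    ContinuousMap.exists_mem_subalgebra_near_continuous_of_isCompact_of_separatesPoints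
      (polyMap_separatesPoints τ) ⟨φ, hφ⟩ hK hε
  refine ⟨q, fun y hy => ?_⟩
  have h := hg y hy
  rw [Real.norm_eq_abs] at h
  change |polyMap τ q y - φ y| < ε at h
  rwa [polyMap_apply] at h

/-! ### §2 The case `r = 2` of Lemma 3: splitting a positive sum over two variable sets -/

/-- The point `(x on T, x' off T)`. [cite: GrimmNetzerSchweighofer2007, §2 proof of Lemma 3] -/
def splice (T : Set σ) [DecidablePred (· ∈ T)] (x x' : σ → ℝ) : σ → ℝ :=
  fun i => if i ∈ T then x i else x' i

section Splice

variable {T : Set σ} [DecidablePred (· ∈ T)]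

/-- [cite: GrimmNetzerSchweighofer2007, §2 proof of Lemma 3] -/
@[simp] theorem splice_of_mem {x x' : σ → ℝ} {i : σ} (hi : i ∈ T) : splice T x x' i = x i := by
  simp [splice, hi]

/-- [cite: GrimmNetzerSchweighofer2007, §2 proof of Lemma 3] -/
@[simp] theorem splice_of_not_mem {x x' : σ → ℝ} {i : σ} (hi : i ∉ T) :
    splice T x x' i = x' i := by
  simp [splice, hi]

/-- [cite: GrimmNetzerSchweighofer2007, §2 proof of Lemma 3] -/
theorem splice_self (x : σ → ℝ) : splice T x x = x := by
  funext i
  by_cases hi : i ∈ T <;> simp [splice, hi]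

/-- [cite: GrimmNetzerSchweighofer2007, §2 proof of Lemma 3] -/
theorem splice_mem_box {K : Set ℝ} {x x' : σ → ℝ} (hx : x ∈ (box K : Set (σ → ℝ)))
    (hx' : x' ∈ (box K : Set (σ → ℝ))) : splice T x x' ∈ (box K : Set (σ → ℝ)) := by
  rw [mem_box] at hx hx' ⊢
  intro i
  by_cases hi : i ∈ T <;> simp [splice, hi, hx i, hx' i]

/-- [cite: GrimmNetzerSchweighofer2007, §2 proof of Lemma 3] -/
theorem splice_congr {x y x' : σ → ℝ} (h : ∀ i ∈ T, x i = y i) : splice T x x' = splice T y x' := by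
  funext i
  by_cases hi : i ∈ T
  · simp [splice, hi, h i hi]
  · simp [splice, hi]

/-- [cite: GrimmNetzerSchweighofer2007, §2 proof of Lemma 3] -/
theorem continuous_splice : Continuous fun p : (σ → ℝ) × (σ → ℝ) => splice T p.1 p.2 := by
  refine continuous_pi fun i => ?_
  by_cases hi : i ∈ T
  · simp only [splice, hi, if_true]
    exact (continuous_apply i).comp continuous_fst
  · simp only [splice, hi, if_false]
    exact (continuous_apply i).comp continuous_snd

end Splice

/-- ★ **Lemma 3, case `r = 2`** [GNS 2007]. `K ⊆ ℝ` compact and non-empty, `f_1 ∈ ℝ[X_A]`,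
`f_2 ∈ ℝ[X_B]`, `f_1 + f_2 > 0` on `K^σ`.  Then there is `p ∈ ℝ[X_{A ∩ B}]` with `f_1 − p > 0` and
`f_2 + p > 0` on `K^σ`.  (Proof as printed: `f ≥ ε > 0` on the compact box;
`h(y) = min{f_1(x, y) | x} − ε/2` is continuous in the `A ∩ B`-coordinates `y`, `f_1 − h ≥ ε/2`
and `f_2 + h ≥ ε/2`; a polynomial `p` in `X_{A∩B}` with `|h − p| < ε/4` does it.)
[cite: GrimmNetzerSchweighofer2007, §2 Lemma 3 (proof, case r = 2)] -/
theorem exists_split_of_pos {K : Set ℝ} (hK : IsCompact K) (hKne : K.Nonempty) {A B : Set σ}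
    {f₁ f₂ : MvPolynomial σ ℝ} (h₁ : f₁ ∈ supported ℝ A) (h₂ : f₂ ∈ supported ℝ B)
    (hpos : ∀ x ∈ (box K : Set (σ → ℝ)), 0 < eval x (f₁ + f₂)) :
    ∃ p ∈ supported ℝ (A ∩ B), (∀ x ∈ (box K : Set (σ → ℝ)), 0 < eval x (f₁ - p)) ∧
      ∀ x ∈ (box K : Set (σ → ℝ)), 0 < eval x (f₂ + p) := by
  classical
  set T : Set σ := A ∩ B with hT
  have hbox : IsCompact (box K : Set (σ → ℝ)) := isCompact_box hK
  have hboxne : (box K : Set (σ → ℝ)).Nonempty := box_nonempty hKne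
  obtain ⟨a₀, ha₀⟩ := hKne
  -- `f ≥ ε > 0` on the box
  obtain ⟨x₀, hx₀, hmin⟩ :=
    hbox.exists_isMinOn hboxne (MvPolynomial.continuous_eval (f₁ + f₂)).continuousOn
  obtain ⟨ε, hε, hεle⟩ : ∃ ε : ℝ, 0 < ε ∧ ∀ x ∈ (box K : Set (σ → ℝ)), ε ≤ eval x (f₁ + f₂) :=
    ⟨eval x₀ (f₁ + f₂), hpos x₀ hx₀, fun x hx => (isMinOn_iff.mp hmin) x hx⟩
  -- the fibre minimum `H x = min {f₁ (x on T, x' off T) | x' ∈ box}` (kept opaque)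
  obtain ⟨F, hFdef⟩ : ∃ F : (σ → ℝ) → (σ → ℝ) → ℝ, ∀ x x', F x x' = eval (splice T x x') f₁ :=
    ⟨fun x x' => eval (splice T x x') f₁, fun _ _ => rfl⟩
  have hF : Continuous (Function.uncurry F) := by
    have hFeq : Function.uncurry F = fun p : (σ → ℝ) × (σ → ℝ) => eval (splice T p.1 p.2) f₁ := by
      funext p
      exact hFdef p.1 p.2
    rw [hFeq]
    exact (MvPolynomial.continuous_eval f₁).comp continuous_splice
  have hFx : ∀ x, Continuous (F x) := fun x =>
    hF.comp (Continuous.prodMk continuous_const continuous_id)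
  obtain ⟨H, hHdef⟩ : ∃ H : (σ → ℝ) → ℝ, ∀ x, H x = sInf (F x '' box K) :=
    ⟨fun x => sInf (F x '' box K), fun _ => rfl⟩
  have hH : Continuous H := by
    have hHeq : H = fun x => sInf (F x '' box K) := funext hHdef
    rw [hHeq]
    exact hbox.continuous_sInf hF
  have hbdd : ∀ x, BddBelow (F x '' box K) := fun x => (hbox.image (hFx x)).bddBelow
  -- (c) `H x ≤ f₁ x` on the box
  have hHle : ∀ x ∈ (box K : Set (σ → ℝ)), H x ≤ eval x f₁ := by
    intro x hx
    rw [hHdef]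
    refine csInf_le (hbdd x) ⟨x, hx, ?_⟩
    rw [hFdef, splice_self]
  -- (d) the minimum is attained
  have hHmem : ∀ x, ∃ x' ∈ (box K : Set (σ → ℝ)), H x = F x x' := by
    intro x
    obtain ⟨x', hx', hval⟩ := (hbox.image (hFx x)).sInf_mem (hboxne.image _)
    exact ⟨x', hx', by rw [hHdef]; exact hval.symm⟩
  -- (e) `f₂ + H ≥ ε` on the box: `f₂(y,z) + f₁(x,y) = f(x,y,z) ≥ ε`
  have hHge : ∀ x ∈ (box K : Set (σ → ℝ)), ε ≤ eval x f₂ + H x := by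
    intro x hx
    obtain ⟨x', hx', hHx⟩ := hHmem x
    have hwbox : splice B x x' ∈ (box K : Set (σ → ℝ)) := splice_mem_box hx hx'
    have hw₂ : eval (splice B x x') f₂ = eval x f₂ :=
      eval_eq_of_mem_supported h₂ fun i hi => splice_of_mem hi
    have hw₁ : eval (splice B x x') f₁ = eval (splice T x x') f₁ := by
      refine eval_eq_of_mem_supported h₁ fun i hi => ?_
      by_cases hiB : i ∈ B
      · have hiT : i ∈ T := ⟨hi, hiB⟩
        rw [splice_of_mem hiB, splice_of_mem hiT]
      · have hiT : i ∉ T := fun h => hiB h.2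
        rw [splice_of_not_mem hiB, splice_of_not_mem hiT]
    have h := hεle _ hwbox
    rw [map_add, hw₁, hw₂, ← hFdef] at h
    rw [hHx]
    linarith
  -- (6) `H` only depends on the `T`-coordinates
  have hHcongr : ∀ x y : σ → ℝ, (∀ i ∈ T, x i = y i) → H x = H y := by
    intro x y hxy
    have hFxy : F x = F y := by
      funext x'
      rw [hFdef, hFdef, splice_congr hxy]
    rw [hHdef, hHdef, hFxy]
  -- (7) approximate `H` on `K^T` by a polynomial in the `T`-variables
  obtain ⟨ext, hext⟩ : ∃ e : (T → ℝ) → (σ → ℝ), ∀ y i,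
      e y i = if h : i ∈ T then y ⟨i, h⟩ else a₀ :=
    ⟨fun y i => if h : i ∈ T then y ⟨i, h⟩ else a₀, fun _ _ => rfl⟩
  have hext_cont : Continuous ext := by
    refine continuous_pi fun i => ?_
    by_cases hi : i ∈ T
    · have heq : (fun y => ext y i) = fun y : T → ℝ => y ⟨i, hi⟩ := by
        funext y
        rw [hext, dif_pos hi]
      rw [heq]
      exact continuous_apply _
    · have heq : (fun y => ext y i) = fun _ : T → ℝ => a₀ := by
        funext y
        rw [hext, dif_neg hi]
      rw [heq]
      exact continuous_const
  have hext_agree : ∀ x : σ → ℝ, ∀ i ∈ T, x i = ext (fun t : T => x (t : σ)) i := by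
    intro x i hi
    rw [hext, dif_pos hi]
  have hKT : IsCompact (box K : Set (T → ℝ)) := isCompact_box hK
  obtain ⟨q, hq⟩ := exists_mvPolynomial_near (τ := T) hKT (hH.comp hext_cont)
    (show (0 : ℝ) < ε / 4 by linarith)
  -- the correcting polynomial `p = q − ε/2` (GNS's `p ≈ h = H − ε/2`)
  have hqx : ∀ x : σ → ℝ, eval x (rename ((↑) : T → σ) q) = eval (fun t : T => x (t : σ)) q := by
    intro x
    rw [eval_rename]
    rfl
  have hyK : ∀ x ∈ (box K : Set (σ → ℝ)), (fun t : T => x (t : σ)) ∈ (box K : Set (T → ℝ)) :=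
    fun x hx => mem_box.2 fun t => (mem_box.1 hx) t
  refine ⟨rename ((↑) : T → σ) q - C (ε / 2), ?_, ?_, ?_⟩
  · exact Subalgebra.sub_mem _ (rename_mem_supported T q) (C_mem_supported T _)
  · intro x hx
    have hHxy : H x = H (ext fun t : T => x (t : σ)) := hHcongr _ _ (hext_agree x)
    have happrox := hq _ (hyK x hx)
    rw [abs_lt, Function.comp_apply, ← hHxy] at happrox
    have h1 := hHle x hx
    rw [map_sub, map_sub, eval_C, hqx]
    linarith [happrox.1, happrox.2]
  · intro x hx
    have hHxy : H x = H (ext fun t : T => x (t : σ)) := hHcongr _ _ (hext_agree x)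
    have happrox := hq _ (hyK x hx)
    rw [abs_lt, Function.comp_apply, ← hHxy] at happrox
    have h2 := hHge x hx
    rw [map_add, map_sub, eval_C, hqx]
    linarith [happrox.1, happrox.2]

/-! ### §3 Lemma 3: positive block summands under the running intersection property -/

section Blocks

variable {r : ℕ}

/-- For the last block of `Fin (r+1)`, `⋃_{j < last} I j = ⋃_{j : Fin r} I (castSucc j)`.
[cite: GrimmNetzerSchweighofer2007, §2 (RIP) and proof of Lemma 3 (induction step)] -/
theorem mem_iUnionLT_last_iff (I : Fin (r + 1) → Set σ) (v : σ) :
    v ∈ iUnionLT I (Fin.last r) ↔ ∃ j : Fin r, v ∈ I (Fin.castSucc j) := by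
  rw [mem_iUnionLT]
  constructor
  · rintro ⟨j, hj, hv⟩
    obtain ⟨j', rfl⟩ := Fin.exists_castSucc_eq.2 hj.ne
    exact ⟨j', hv⟩
  · rintro ⟨j, hv⟩
    exact ⟨Fin.castSucc j, Fin.castSucc_lt_last j, hv⟩

/-- (RIP) restricts to the first `r` of `r + 1` blocks.
[cite: GrimmNetzerSchweighofer2007, §2 (RIP) and proof of Lemma 3 (induction step)] -/
theorem indexedRunningIntersection_castSucc {I : Fin (r + 1) → Set σ}
    (h : IndexedRunningIntersection I) :
    IndexedRunningIntersection (fun j : Fin r => I (Fin.castSucc j)) := by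
  intro i hi
  obtain ⟨k, hk, hsub⟩ := h (Fin.castSucc i) (by simpa using hi)
  obtain ⟨k', rfl⟩ := Fin.exists_castSucc_eq.2 (lt_trans hk (Fin.castSucc_lt_last i)).ne
  refine ⟨k', Fin.castSucc_lt_castSucc_iff.1 hk, ?_⟩
  rintro v ⟨hv, hv'⟩
  refine hsub ⟨hv, ?_⟩
  rw [mem_iUnionLT] at hv' ⊢
  obtain ⟨j, hj, hvj⟩ := hv'
  exact ⟨Fin.castSucc j, Fin.castSucc_lt_castSucc_iff.2 hj, hvj⟩

/-- Lemma 3 for non-empty `K`, by induction on the number of blocks (GNS's induction: split off the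
last block with `exists_split_of_pos`, move the correcting polynomial into the block `I_k`, `k < r`,
provided by (RIP), and recurse). [cite: GrimmNetzerSchweighofer2007, §2 Lemma 3 (proof)] -/
private theorem exists_pos_summands_aux {K : Set ℝ} (hK : IsCompact K) (hKne : K.Nonempty) :
    ∀ (r : ℕ) (I : Fin r → Set σ), IndexedRunningIntersection I →
    ∀ f : Fin r → MvPolynomial σ ℝ, (∀ j, f j ∈ supported ℝ (I j)) →
    (∀ x ∈ (box K : Set (σ → ℝ)), 0 < eval x (∑ j, f j)) →
    ∃ h : Fin r → MvPolynomial σ ℝ, (∀ j, h j ∈ supported ℝ (I j)) ∧ ∑ j, h j = ∑ j, f j ∧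
      ∀ j, ∀ x ∈ (box K : Set (σ → ℝ)), 0 < eval x (h j) := by
  classical
  intro r
  induction r with
  | zero =>
    intro I _ f hf _
    exact ⟨f, hf, rfl, fun j => Fin.elim0 j⟩
  | succ r ih =>
    intro I hRIP f hf hpos
    rcases Nat.eq_zero_or_pos r with hr | hr
    · -- a single block: nothing to do
      subst hr
      refine ⟨f, hf, rfl, fun j x hx => ?_⟩
      obtain rfl : j = 0 := Subsingleton.elim (α := Fin 1) _ _
      simpa [Fin.sum_univ_succ] using hpos x hx
    · -- `f = f̃ + f_last`, `f̃` in the variables `A = ⋃_{j<last} I j`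
      have hft : (∑ j : Fin r, f (Fin.castSucc j)) ∈ supported ℝ (iUnionLT I (Fin.last r)) := by
        refine Subalgebra.sum_mem _ fun j _ => supported_mono ?_ (hf _)
        intro v hv
        exact (mem_iUnionLT_last_iff I v).2 ⟨j, hv⟩
      have hsum : ∑ j, f j = (∑ j : Fin r, f (Fin.castSucc j)) + f (Fin.last r) :=
        Fin.sum_univ_castSucc f
      have hpos' : ∀ x ∈ (box K : Set (σ → ℝ)),
          0 < eval x ((∑ j : Fin r, f (Fin.castSucc j)) + f (Fin.last r)) := by
        intro x hx
        rw [← hsum]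
        exact hpos x hx
      obtain ⟨p, hp, hp₁, hp₂⟩ := exists_split_of_pos hK hKne hft (hf (Fin.last r)) hpos'
      -- (RIP) at the last block: the shared variables lie in one earlier block `I k`
      obtain ⟨k, hk, hsub⟩ := hRIP (Fin.last r) (by simpa using hr)
      obtain ⟨k', rfl⟩ := Fin.exists_castSucc_eq.2 hk.ne
      have hpk : p ∈ supported ℝ (I (Fin.castSucc k')) := by
        refine supported_mono ?_ hp
        rintro v ⟨hvA, hvB⟩
        exact hsub ⟨hvB, hvA⟩
      -- the corrected family on the first `r` blocks
      obtain ⟨f', hf'def⟩ : ∃ f' : Fin r → MvPolynomial σ ℝ,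
          ∀ j, f' j = f (Fin.castSucc j) - if j = k' then p else 0 :=
        ⟨fun j => f (Fin.castSucc j) - if j = k' then p else 0, fun _ => rfl⟩
      have hf'mem : ∀ j, f' j ∈ supported ℝ (I (Fin.castSucc j)) := by
        intro j
        rw [hf'def]
        refine Subalgebra.sub_mem _ (hf _) ?_
        by_cases hj : j = k'
        · subst hj
          rw [if_pos rfl]
          exact hpk
        · rw [if_neg hj]
          exact Subalgebra.zero_mem _
      have hsum' : ∑ j, f' j = (∑ j : Fin r, f (Fin.castSucc j)) - p := by
        rw [Finset.sum_congr rfl fun j _ => hf'def j, Finset.sum_sub_distrib, Finset.sum_ite_eq']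
        simp
      have hpos'' : ∀ x ∈ (box K : Set (σ → ℝ)), 0 < eval x (∑ j, f' j) := by
        intro x hx
        rw [hsum']
        exact hp₁ x hx
      obtain ⟨h', hh'mem, hh'sum, hh'pos⟩ :=
        ih (fun j => I (Fin.castSucc j)) (indexedRunningIntersection_castSucc hRIP) f' hf'mem hpos''
      refine ⟨Fin.snoc h' (f (Fin.last r) + p), fun j => ?_, ?_, fun j => ?_⟩
      · induction j using Fin.lastCases with
        | last =>
          rw [Fin.snoc_last]
          refine Subalgebra.add_mem _ (hf _) (supported_mono ?_ hp)
          rintro v ⟨-, hvB⟩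
          exact hvB
        | cast j =>
          rw [Fin.snoc_castSucc]
          exact hh'mem j
      · rw [Fin.sum_univ_castSucc, hsum]
        simp only [Fin.snoc_castSucc, Fin.snoc_last, hh'sum, hsum']
        ring
      · induction j using Fin.lastCases with
        | last =>
          rw [Fin.snoc_last]
          exact hp₂
        | cast j =>
          rw [Fin.snoc_castSucc]
          exact hh'pos j

/-- ★ **Lemma 3** [GNS 2007]. «Let `K ⊆ ℝ` be compact. Suppose `f = f_1 + … + f_r` with
`f_j ∈ ℝ[X_{I_j}]` and `f > 0` on `Kⁿ`. Then `f = h_1 + … + h_r` for some `h_j ∈ ℝ[X_{I_j}]` with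
`h_j > 0` on `K^{I_j}`.»  Blocks `I_1,…,I_r` non-empty with (RIP).
[cite: GrimmNetzerSchweighofer2007, §2 Lemma 3] -/
theorem exists_pos_summands {K : Set ℝ} (hK : IsCompact K) (I : Fin r → Set σ)
    (hI : ∀ j, (I j).Nonempty) (hRIP : IndexedRunningIntersection I)
    (f : Fin r → MvPolynomial σ ℝ) (hf : ∀ j, f j ∈ supported ℝ (I j))
    (hpos : ∀ x ∈ (box K : Set (σ → ℝ)), 0 < eval x (∑ j, f j)) :
    ∃ h : Fin r → MvPolynomial σ ℝ, (∀ j, h j ∈ supported ℝ (I j)) ∧ ∑ j, h j = ∑ j, f j ∧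
      ∀ j, ∀ x ∈ (box K : Set (σ → ℝ)), 0 < eval x (h j) := by
  by_cases hKne : K.Nonempty
  · exact exists_pos_summands_aux hK hKne r I hRIP f hf hpos
  · -- `K = ∅`: the blocks are non-empty, so `Kⁿ = ∅` and `h := f` will do
    refine ⟨f, hf, rfl, fun j x hx => ?_⟩
    obtain ⟨i, -⟩ := hI j
    exact absurd ⟨x i, (mem_box.1 hx) i⟩ hKne

end Blocks

/-! ### §4 Theorem 4: the damping terms `(1 − λ g)^{2k} g` -/

/-- The damping term `t_k(a) = (1 − λ a)^{2k} a` is non-increasing in `k` when `λ a ≤ 1`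
(«We have `f_k ≤ f_{k+1}` on `Kⁿ`»). [cite: GrimmNetzerSchweighofer2007, §2 proof of Theorem 4] -/
theorem damping_succ_le {lam a : ℝ} (hlam : 0 < lam) (ha : lam * a ≤ 1) (k : ℕ) :
    (1 - lam * a) ^ (2 * (k + 1)) * a ≤ (1 - lam * a) ^ (2 * k) * a := by
  rcases le_or_gt 0 a with ha0 | ha0
  · have h0 : 0 ≤ 1 - lam * a := by linarith
    have h1 : 1 - lam * a ≤ 1 := by nlinarith
    exact mul_le_mul_of_nonneg_right (pow_le_pow_of_le_one h0 h1 (by omega)) ha0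
  · have h1 : 1 ≤ 1 - lam * a := by nlinarith
    exact mul_le_mul_of_nonpos_right (pow_le_pow_right₀ h1 (by omega)) ha0.le

/-- For `a ≥ 0` with `λ a ≤ 1` the damping term tends to `0`.
[cite: GrimmNetzerSchweighofer2007, §2 proof of Theorem 4] -/
theorem tendsto_damping_of_nonneg {lam a : ℝ} (hlam : 0 < lam) (ha : lam * a ≤ 1) (ha0 : 0 ≤ a) :
    Tendsto (fun k : ℕ => (1 - lam * a) ^ (2 * k) * a) atTop (𝓝 0) := by
  rcases ha0.eq_or_lt with h | ha0'
  · subst h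
    simp
  · have h0 : 0 ≤ 1 - lam * a := by linarith
    have h1' : 1 - lam * a < 1 := by nlinarith [mul_pos hlam ha0']
    have h1 : (1 - lam * a) ^ 2 < 1 := pow_lt_one₀ h0 h1' two_ne_zero
    have ht : Tendsto (fun k : ℕ => ((1 - lam * a) ^ 2) ^ k) atTop (𝓝 0) :=
      tendsto_pow_atTop_nhds_zero_of_lt_one (sq_nonneg _) h1
    have := ht.mul_const a
    simpa [pow_mul] using this

/-- For `a < 0` the damping term tends to `−∞`.
[cite: GrimmNetzerSchweighofer2007, §2 proof of Theorem 4] -/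
theorem tendsto_damping_of_neg {lam a : ℝ} (hlam : 0 < lam) (ha0 : a < 0) :
    Tendsto (fun k : ℕ => (1 - lam * a) ^ (2 * k) * a) atTop atBot := by
  have h1' : 1 < 1 - lam * a := by nlinarith [mul_pos hlam (neg_pos.2 ha0)]
  have h1 : 1 < (1 - lam * a) ^ 2 := one_lt_pow₀ h1' two_ne_zero
  have ht : Tendsto (fun k : ℕ => ((1 - lam * a) ^ 2) ^ k) atTop atTop :=
    tendsto_pow_atTop_atTop_of_one_lt h1
  have := ht.atTop_mul_const_of_neg ha0
  simpa [pow_mul] using this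

/-- The damping term is at most `max(a, 0)` when `λ a ≤ 1`.
[cite: GrimmNetzerSchweighofer2007, §2 proof of Theorem 4] -/
theorem damping_le_max {lam a : ℝ} (hlam : 0 < lam) (ha : lam * a ≤ 1) (k : ℕ) :
    (1 - lam * a) ^ (2 * k) * a ≤ max a 0 := by
  rcases le_or_gt 0 a with h0 | h0
  · have h1 : (1 - lam * a) ^ (2 * k) ≤ 1 := pow_le_one₀ (by linarith) (by nlinarith)
    calc (1 - lam * a) ^ (2 * k) * a ≤ 1 * a := mul_le_mul_of_nonneg_right h1 h0
      _ ≤ max a 0 := by rw [one_mul]; exact le_max_left _ _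
  · calc (1 - lam * a) ^ (2 * k) * a ≤ 0 :=
          mul_nonpos_of_nonneg_of_nonpos ((even_two_mul k).pow_nonneg _) h0.le
      _ ≤ max a 0 := le_max_right _ _

/-- «one checks that for all `x ∈ Kⁿ` there exists `k ∈ ℕ` such that `f_k(x) > 0`»: at a point
where all `g ≥ 0` the damping terms tend to `0` while `f > 0`; at a point where some `g < 0` that
term tends to `−∞` and the others are bounded. [cite: GrimmNetzerSchweighofer2007, §2 proof of Theorem 4] -/
theorem exists_damped_pos {κ : Type*} [Fintype κ] {lam : ℝ} (hlam : 0 < lam) (a : κ → ℝ)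
    (ha : ∀ c, lam * a c ≤ 1) (v : ℝ) (hv : (∀ c, 0 ≤ a c) → 0 < v) :
    ∃ k : ℕ, 0 < v - ∑ c, (1 - lam * a c) ^ (2 * k) * a c := by
  classical
  by_cases hall : ∀ c, 0 ≤ a c
  · have ht : Tendsto (fun k : ℕ => ∑ c, (1 - lam * a c) ^ (2 * k) * a c) atTop
        (𝓝 (∑ _c : κ, (0 : ℝ))) :=
      tendsto_finsetSum _ fun c _ => tendsto_damping_of_nonneg hlam (ha c) (hall c)
    rw [Finset.sum_const_zero] at ht
    obtain ⟨k, hk⟩ := (ht.eventually_lt_const (hv hall)).exists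
    exact ⟨k, by linarith⟩
  · obtain ⟨c₀, hc₀'⟩ := not_forall.mp hall
    have hc₀ : a c₀ < 0 := lt_of_not_ge hc₀'
    have ht := tendsto_damping_of_neg hlam hc₀
    obtain ⟨k, hk⟩ :=
      (ht.eventually_lt_atBot (v - ∑ c ∈ Finset.univ.erase c₀, max (a c) 0)).exists
    refine ⟨k, ?_⟩
    rw [← Finset.add_sum_erase _ _ (Finset.mem_univ c₀)]
    have hrest : ∑ c ∈ Finset.univ.erase c₀, (1 - lam * a c) ^ (2 * k) * a c ≤
        ∑ c ∈ Finset.univ.erase c₀, max (a c) 0 :=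
      Finset.sum_le_sum fun c _ => damping_le_max hlam (ha c) k
    linarith

section Fintype

variable [Fintype σ]

/-- A bounded set `C ⊆ ℝⁿ` lies in a cube `[−R, R]ⁿ` («Choose a compact set `K ⊂ ℝ` such that
`C ⊆ Kⁿ`»). [cite: GrimmNetzerSchweighofer2007, §2 proof of Theorem 4] -/
theorem exists_subset_box_Icc_of_isBounded {D : Set (σ → ℝ)} (hD : Bornology.IsBounded D) :
    ∃ R : ℝ, 0 ≤ R ∧ D ⊆ box (Set.Icc (-R) R) := by
  obtain ⟨R, hR⟩ := hD.subset_closedBall 0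
  refine ⟨|R|, abs_nonneg R, fun x hx => mem_box.2 fun i => ?_⟩
  have h1 : ‖x‖ ≤ R := by simpa [dist_zero_right] using hR hx
  have h2 : ‖x i‖ ≤ ‖x‖ := norm_le_pi_norm x i
  rw [Real.norm_eq_abs] at h2
  have h3 : |x i| ≤ |R| := h2.trans (h1.trans (le_abs_self R))
  exact ⟨(abs_le.1 h3).1, (abs_le.1 h3).2⟩

/-- ★★ **Theorem 4** [GNS 2007]. Blocks `I_1,…,I_r` (non-empty, (RIP)); constraints
`g_i^{(j)} ∈ ℝ[X_{I_j}]` defining `S = {x | all g_i^{(j)}(x) ≥ 0}`; `f = f_1 + … + f_r`,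
`f_j ∈ ℝ[X_{I_j}]`, `f > 0` on `S`.  «Then for any bounded set `C ⊆ ℝⁿ`, there are `0 < λ ≤ 1`,
`k ∈ ℕ` and polynomials `h_j ∈ ℝ[X_{I_j}]` with `h_j > 0` on `C` such that
`f = Σ_j Σ_i (1 − λ g_i^{(j)})^{2k} g_i^{(j)} + Σ_j h_j`.» (The bounded set is `D` here, `C` being
Mathlib's constant-polynomial map.) [cite: GrimmNetzerSchweighofer2007, §2 Theorem 4] -/
theorem exists_sparse_decomposition {r : ℕ} (I : Fin r → Set σ) (hI : ∀ j, (I j).Nonempty)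
    (hRIP : IndexedRunningIntersection I) {ι : Fin r → Type*} [∀ j, Fintype (ι j)]
    (g : (j : Fin r) → ι j → MvPolynomial σ ℝ) (hg : ∀ j i, g j i ∈ supported ℝ (I j))
    (f : Fin r → MvPolynomial σ ℝ) (hf : ∀ j, f j ∈ supported ℝ (I j))
    (hpos : ∀ x : σ → ℝ, (∀ j i, 0 ≤ eval x (g j i)) → 0 < eval x (∑ j, f j))
    {D : Set (σ → ℝ)} (hD : Bornology.IsBounded D) :
    ∃ (lam : ℝ) (k : ℕ) (h : Fin r → MvPolynomial σ ℝ), 0 < lam ∧ lam ≤ 1 ∧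
      (∀ j, h j ∈ supported ℝ (I j)) ∧ (∀ j, ∀ x ∈ D, 0 < eval x (h j)) ∧
      ∑ j, f j = ∑ j, ∑ i, (1 - C lam * g j i) ^ (2 * k) * g j i + ∑ j, h j := by
  classical
  -- `C ⊆ Kⁿ` with `K = [−R, R]`
  obtain ⟨R, hR, hDK⟩ := exists_subset_box_Icc_of_isBounded hD
  obtain ⟨K, hKdef⟩ : ∃ K : Set ℝ, K = Set.Icc (-R) R := ⟨_, rfl⟩
  rw [← hKdef] at hDK
  have hK : IsCompact K := by rw [hKdef]; exact isCompact_Icc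
  have hKne : K.Nonempty := ⟨0, by rw [hKdef]; exact ⟨by linarith, hR⟩⟩
  have hbox : IsCompact (box K : Set (σ → ℝ)) := isCompact_box hK
  -- `0 < λ ≤ 1` with `λ g ≤ 1` on `Kⁿ`
  have hbdd : ∀ j i, ∃ M : ℝ, ∀ x ∈ (box K : Set (σ → ℝ)), eval x (g j i) ≤ M := by
    intro j i
    obtain ⟨M, hM⟩ := hbox.bddAbove_image (MvPolynomial.continuous_eval (g j i)).continuousOn
    exact ⟨M, fun x hx => hM ⟨x, hx, rfl⟩⟩
  choose M hM using hbdd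
  obtain ⟨lam, hlam, hlam1, hlamg⟩ : ∃ lam : ℝ, 0 < lam ∧ lam ≤ 1 ∧
      ∀ j i, ∀ x ∈ (box K : Set (σ → ℝ)), lam * eval x (g j i) ≤ 1 := by
    have hMtot : (0 : ℝ) < 1 + ∑ j, ∑ i, |M j i| := by positivity
    refine ⟨1 / (1 + ∑ j, ∑ i, |M j i|), by positivity, ?_, fun j i x hx => ?_⟩
    · rw [div_le_one hMtot]
      have : (0 : ℝ) ≤ ∑ j, ∑ i, |M j i| := by positivity
      linarith
    · have h1 : eval x (g j i) ≤ 1 + ∑ j, ∑ i, |M j i| := by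
        have h2 : |M j i| ≤ ∑ i', |M j i'| :=
          Finset.single_le_sum (f := fun i' => |M j i'|) (fun _ _ => abs_nonneg _) (Finset.mem_univ i)
        have h3 : ∑ i', |M j i'| ≤ ∑ j', ∑ i', |M j' i'| :=
          Finset.single_le_sum (f := fun j' => ∑ i', |M j' i'|) (fun _ _ => by positivity)
            (Finset.mem_univ j)
        linarith [hM j i x hx, le_abs_self (M j i)]
      rw [one_div, inv_mul_le_iff₀ hMtot]
      linarith
  -- the damped polynomials `f_k` and their block structure
  obtain ⟨P, hPdef⟩ : ∃ P : ℕ → MvPolynomial σ ℝ,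
      ∀ k, P k = ∑ j, f j - ∑ j, ∑ i, (1 - C lam * g j i) ^ (2 * k) * g j i := ⟨_, fun _ => rfl⟩
  have hPeval : ∀ k x, eval x (P k) =
      eval x (∑ j, f j) - ∑ j, ∑ i, (1 - lam * eval x (g j i)) ^ (2 * k) * eval x (g j i) := by
    intro k x
    simp only [hPdef, map_sub, map_sum, map_mul, map_pow, map_one, eval_C]
  -- monotone in `k` on the box
  have hmono : ∀ x ∈ (box K : Set (σ → ℝ)), Monotone fun k => eval x (P k) := by
    intro x hx
    refine monotone_nat_of_le_succ fun k => ?_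
    rw [hPeval, hPeval]
    have : ∑ j, ∑ i, (1 - lam * eval x (g j i)) ^ (2 * (k + 1)) * eval x (g j i) ≤
        ∑ j, ∑ i, (1 - lam * eval x (g j i)) ^ (2 * k) * eval x (g j i) :=
      Finset.sum_le_sum fun j _ => Finset.sum_le_sum fun i _ =>
        damping_succ_le hlam (hlamg j i x hx) k
    linarith
  -- eventually positive at each point of the box
  have hev : ∀ x ∈ (box K : Set (σ → ℝ)), ∃ k, 0 < eval x (P k) := by
    intro x hx
    obtain ⟨k, hk⟩ := exists_damped_pos (κ := (j : Fin r) × ι j) hlam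
      (fun c => eval x (g c.1 c.2)) (fun c => hlamg c.1 c.2 x hx) (eval x (∑ j, f j))
      (fun hall => hpos x fun j i => hall ⟨j, i⟩)
    refine ⟨k, ?_⟩
    rw [hPeval]
    rw [Fintype.sum_sigma' (fun j i => (1 - lam * eval x (g j i)) ^ (2 * k) * eval x (g j i))] at hk
    exact hk
  -- by compactness one `k` works on the whole box
  obtain ⟨k, hk⟩ : ∃ k : ℕ, ∀ x ∈ (box K : Set (σ → ℝ)), 0 < eval x (P k) := by
    obtain ⟨U, hUdef⟩ : ∃ U : ℕ → Set (σ → ℝ), ∀ k, U k = {x | 0 < eval x (P k)} ∪ (box K)ᶜ :=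
      ⟨_, fun _ => rfl⟩
    have hUo : ∀ k, IsOpen (U k) := fun k => by
      rw [hUdef]
      exact (isOpen_lt continuous_const (MvPolynomial.continuous_eval (P k))).union
        hbox.isClosed.isOpen_compl
    have hUcov : (box K : Set (σ → ℝ)) ⊆ ⋃ k, U k := by
      intro x hx
      obtain ⟨k, hk⟩ := hev x hx
      exact Set.mem_iUnion.2 ⟨k, by rw [hUdef]; exact Or.inl hk⟩
    have hUmono : Monotone U := by
      intro k k' hkk' x hx
      rw [hUdef] at hx ⊢
      rcases hx with hx | hx
      · by_cases hxb : x ∈ (box K : Set (σ → ℝ))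
        · exact Or.inl (lt_of_lt_of_le hx (hmono x hxb hkk'))
        · exact Or.inr hxb
      · exact Or.inr hx
    obtain ⟨k, hk⟩ := hbox.elim_directed_cover U hUo hUcov hUmono.directed_le
    refine ⟨k, fun x hx => ?_⟩
    have hxU := hk hx
    rw [hUdef] at hxU
    rcases hxU with h | h
    · exact h
    · exact absurd hx h
  -- apply Lemma 3 to `f_k`, block by block
  obtain ⟨u, hudef⟩ : ∃ u : Fin r → MvPolynomial σ ℝ,
      ∀ j, u j = f j - ∑ i, (1 - C lam * g j i) ^ (2 * k) * g j i := ⟨_, fun _ => rfl⟩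
  have humem : ∀ j, u j ∈ supported ℝ (I j) := by
    intro j
    rw [hudef]
    refine Subalgebra.sub_mem _ (hf j) (Subalgebra.sum_mem _ fun i _ => ?_)
    refine Subalgebra.mul_mem _ (Subalgebra.pow_mem _ ?_ _) (hg j i)
    exact Subalgebra.sub_mem _ (Subalgebra.one_mem _)
      (Subalgebra.mul_mem _ (C_mem_supported _ _) (hg j i))
  have husum : ∑ j, u j = P k := by
    rw [hPdef, Finset.sum_congr rfl fun j _ => hudef j, Finset.sum_sub_distrib]
  have hupos : ∀ x ∈ (box K : Set (σ → ℝ)), 0 < eval x (∑ j, u j) := by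
    intro x hx
    rw [husum]
    exact hk x hx
  obtain ⟨h, hhmem, hhsum, hhpos⟩ := exists_pos_summands hK I hI hRIP u humem hupos
  refine ⟨lam, k, h, hlam, hlam1, hhmem, fun j x hx => hhpos j x (hDK hx), ?_⟩
  rw [hhsum, husum, hPdef]
  ring

/-- The cube `[−R, R]ⁿ` is bounded. [cite: GrimmNetzerSchweighofer2007, §2 proof of Corollary 5] -/
theorem isBounded_box_Icc (R : ℝ) : Bornology.IsBounded (box (Set.Icc (-R) R) : Set (σ → ℝ)) := by
  refine (Metric.isBounded_closedBall (x := (0 : σ → ℝ)) (r := |R|)).subset fun x hx => ?_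
  rw [Metric.mem_closedBall, dist_zero_right, pi_norm_le_iff_of_nonneg (abs_nonneg R)]
  intro i
  rw [Real.norm_eq_abs]
  obtain ⟨h1, h2⟩ := (mem_box.1 hx) i
  exact abs_le.2 ⟨by linarith [le_abs_self R], h2.trans (le_abs_self R)⟩

/-! ### §5 Corollary 5: Lasserre's sparse Putinar representation -/

/-- ★★ **Corollary 5 (Lasserre 2006, Cor. 3.9; Kojima–Muramatsu; Grimm–Netzer–Schweighofer 2007).**
Blocks `I_1,…,I_r ⊆ σ` (non-empty, running intersection property); for each `j` finitely many
constraints `g_i^{(j)}` in the polynomial ring `ℝ[X_{I_j}]` (`MvPolynomial ↥(I j) ℝ`) whose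
quadratic module `M_j = quadraticModule (g j)` is archimedean;
`S = {x ∈ ℝ^σ | g_i^{(j)}(x|_{I_j}) ≥ 0 for all j, i}`.  «If `f ∈ ℝ[X_{I_1}] + … + ℝ[X_{I_r}]` and
`f > 0` on `S`, then `f ∈ M_1 + … + M_r`»: `f = Σ_j f_j = Σ_j rename(m_j)` with `m_j ∈ M_j`, i.e.
`f = Σ_j (σ_j + Σ_i σ_{ji} g_i^{(j)})` with sums of squares `σ_j, σ_{ji} ∈ ℝ[X_{I_j}]`
(Lasserre's (3.15)).  Putinar's theorem is the tree's proved `mem_quadraticModule_of_pos'`.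
[cite: GrimmNetzerSchweighofer2007, §2 Corollary 5] [cite: Lasserre2006, Corollary 3.9 and (1.3) (pp. 3, 11)] -/
theorem sparse_putinar {r : ℕ} (I : Fin r → Set σ) [∀ j, Fintype (I j)] (hI : ∀ j, (I j).Nonempty)
    (hRIP : IndexedRunningIntersection I) {ι : Fin r → Type*} [∀ j, Fintype (ι j)]
    (g : (j : Fin r) → ι j → MvPolynomial (I j) ℝ)
    (hArch : ∀ j, IsArchimedeanModule (quadraticModule (g j)))
    (f : Fin r → MvPolynomial σ ℝ) (hf : ∀ j, f j ∈ supported ℝ (I j))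
    (hpos : ∀ x : σ → ℝ, (∀ j i, 0 ≤ eval (fun v : I j => x v) (g j i)) → 0 < eval x (∑ j, f j)) :
    ∃ m : (j : Fin r) → MvPolynomial (I j) ℝ, (∀ j, m j ∈ quadraticModule (g j)) ∧
      ∑ j, f j = ∑ j, rename ((↑) : I j → σ) (m j) := by
  classical
  -- a common radius: `S_j ⊆ {‖z‖² ≤ N j}` by archimedeanity
  have hNj : ∀ j, ∃ N : ℕ, ∀ z ∈ semialgSet (g j), ∑ v, z v ^ 2 ≤ N := fun j =>
    sum_sq_le_of_archimedean (hArch j)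
  choose N hN using hNj
  have hN0 : (0 : ℝ) ≤ ∑ j, (N j : ℝ) := by positivity
  obtain ⟨Ntot, hNtot1, hNtotj⟩ : ∃ Nt : ℝ, 1 ≤ Nt ∧ ∀ j, (N j : ℝ) ≤ Nt := by
    refine ⟨1 + ∑ j, (N j : ℝ), by linarith, fun j => ?_⟩
    have : (N j : ℝ) ≤ ∑ j', (N j' : ℝ) :=
      Finset.single_le_sum (f := fun j' => (N j' : ℝ)) (fun _ _ => by positivity) (Finset.mem_univ j)
    linarith
  have hNtot0 : (0 : ℝ) ≤ Ntot := by linarith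
  -- the bounded set `C = [−Ntot, Ntot]ⁿ ⊇ S_j × anything`
  have hD : Bornology.IsBounded (box (Set.Icc (-Ntot) Ntot) : Set (σ → ℝ)) := isBounded_box_Icc Ntot
  -- Theorem 4 with the constraints transported to `ℝ[X]`
  obtain ⟨lam, k, h, hlam, -, hh, hhpos, hsum⟩ := exists_sparse_decomposition I hI hRIP
    (fun j i => rename ((↑) : I j → σ) (g j i)) (fun j i => rename_mem_supported _ _) f hf
    (fun x hx => hpos x fun j i => by simpa [eval_rename, Function.comp_def] using hx j i) hD
  -- each `h_j` is a polynomial in `X_{I_j}` positive on `S_j`, hence in `M_j` (Putinar)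
  have hm' : ∀ j, ∃ m' : MvPolynomial (I j) ℝ,
      h j = rename ((↑) : I j → σ) m' ∧ m' ∈ quadraticModule (g j) := by
    intro j
    obtain ⟨m', hm'⟩ := exists_eq_rename_of_mem_supported (hh j)
    refine ⟨m', hm', mem_quadraticModule_of_pos' (g j) (hArch j) fun z hz => ?_⟩
    -- extend `z ∈ S_j` by `0` to a point of the cube
    obtain ⟨x, hxdef⟩ : ∃ x : σ → ℝ, ∀ v, x v = if hv : v ∈ I j then z ⟨v, hv⟩ else 0 :=
      ⟨_, fun _ => rfl⟩
    have hxz : (x ∘ ((↑) : I j → σ)) = z := by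
      funext v
      rw [Function.comp_apply, hxdef, dif_pos v.2]
    have hxD : x ∈ (box (Set.Icc (-Ntot) Ntot) : Set (σ → ℝ)) := by
      refine mem_box.2 fun v => ?_
      rw [hxdef]
      by_cases hv : v ∈ I j
      · rw [dif_pos hv]
        have h1 : z ⟨v, hv⟩ ^ 2 ≤ ∑ w, z w ^ 2 :=
          Finset.single_le_sum (f := fun w => z w ^ 2) (fun w _ => sq_nonneg (z w))
            (Finset.mem_univ _)
        have h2 : ∑ w, z w ^ 2 ≤ (N j : ℝ) := hN j z hz
        have h4 : z ⟨v, hv⟩ ^ 2 ≤ Ntot ^ 2 := by nlinarith [hNtotj j]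
        exact abs_le_of_sq_le_sq' h4 hNtot0
      · rw [dif_neg hv]
        exact ⟨by linarith, hNtot0⟩
    have := hhpos j x hxD
    rwa [hm', eval_rename, hxz] at this
  choose m' hm'eq hm'mem using hm'
  refine ⟨fun j => ∑ i, (1 - C lam * g j i) ^ (2 * k) * g j i + m' j, fun j => ?_, ?_⟩
  · have hQ := isQuadraticModule_quadraticModule (g j)
    refine hQ.2.1 _ (hQ.sum_mem _ fun i _ => ?_) _ (hm'mem j)
    have : (1 - C lam * g j i) ^ (2 * k) * g j i =
        (1 - C lam * g j i) ^ k * (1 - C lam * g j i) ^ k * g j i := by ring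
    rw [this]
    exact hQ.2.2 _ _ (mem_quadraticModule_gen (g j) i)
  · rw [hsum]
    simp only [map_add, map_sum, map_mul, map_pow, map_sub, map_one, rename_C, hm'eq,
      Finset.sum_add_distrib]

end Fintype

end Literature.Algebra.Polynomial.SparsePutinarPositivstellensatz
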